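/-
Copyright (c) 2026 the pub-hodgecm-mathlib formalisation cell (harness21).  Prover seat hodgecm-mathlib-LH4-p05 (g2): Track A «(D-RAM) FOUR-FRAME» squad of crux H413
(dealer LH4-plan (g10) WORD #46 «p05 (g2) DEFAULT «=»: (ρ) ROW (3) TYPE-UNIT organ», brick F3), 2026-09-03.
The √u-TYPE companion of ★ `UnitaryTwoEdgeStabilizerVertexAverageRamifiedOdd` (LH4-p05 (g0), p855239): the pointwise organ of the `K⁰`-average at a place with an anti-fixed UNIT.
-/
import Literature.NumberTheory.Automorphic.UnitaryTwoEdgeStabilizerVertexAverageRamified   -- ★ FILE A+B (F0P3a-p04): `coe_localNonsplitEquiv_conj∕_mem_glInt_of_mem`, `forall_v_sharp_conj_iff_sharp_of_diagType`, `coe_mem_glInt_iff_forall_v_le_one`, `v_det_coe_eq_one_of_mem_placeForm`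
import Literature.NumberTheory.Rogawski1990.DepthZeroTransferHValuesLeviRamifiedModular    -- ★ tame head (F0P3a-p07): `map_coe_torus_mul_unipotent_two` (`(t·n)_w = [[d₀, d₀y],[0, d₁]]`), `coe_localNonsplitEquiv_two_eq_map`; brings the CM Levi carriers
import Literature.NumberTheory.LocalFields.RamifiedPlaceAntiFixedUnitParity                -- ★ F1 (this seat): anti-fixed unit ⇒ `|y|_w ≤ exp 1 → |y|_w ≤ 1` on the skew line
import HarnessLib

/-!
# The pointwise organ of the `K⁰`-average at a ramified place with an anti-fixed UNIT (√u-type): for `k ∈ K⁰`, a deep diagonal `t` and `n = n(y) ∈ N₂`,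
# `k(tn)k⁻¹ ∈ K♯ ⟺ |y_w| ≤ 1 ∧ (|y_w| < 1 ∨ |k₁₀,w| < 1)` (Tits 1979 §3.9; Serre, *Trees* II.1.3; Rogawski 1990 §4.9)

Topic `NumberTheory/Automorphic`; namespace `Literature.NumberTheory.Automorphic.UnitaryGroup` (as ★ FILE A∕B).  THEOREMS ONLY (no definition, no instance, no notation, no
named fact, no `sorry`); lane `--supports stmt-HodgeConjecture-24833`.  Cell `pub/hodgecm-mathlib`, crux H413; Track A «(D-RAM) FOUR-FRAME», unit U2H, (ρ) ROW (3) = child (f)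
«Levi row», TYPE-UNIT half (LH4-p05 lineage; census v3 §3; dealer WORD #46).  HONEST LABEL: HC_CM is proved only modulo the 7 printed citations (2 remaining named inputs:
hLiu418 = `stmt-HodgeConjecture-24832`, h413 = `stmt-HodgeConjecture-24833`) until rung 0 closes; this file asserts nothing printed and freezes no stub text.

THE MATHEMATICS.  `L` CM, `w ∣ v` non-split and ramified, carrying an anti-fixed UNIT `α` (`σ_w α = −α`, `|α|_w = 1`: the wild type `L_w = L⁺_v(√u)`); `E₂ : U(Φ₂)(L⁺_v) ≃ U_w ≤
GL₂(L_w)` the one-place model; `K⁰ = U_w ∩ GL₂(𝒪_w)` — at such a place a VERTEX stabiliser of the tree of `SL₂(L⁺_v)` (★ `coe_mem_glInt_iff_glVertexAct_root_eq_of_v_eq_one`), whose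
residual image is all of `SL₂(𝓀_w)`; for a uniformiser `ϖ` of `L_w`, `K♯ = U_w ∩ D_ϖ GL₂(𝒪_w) D_ϖ⁻¹` (entry currency `P♯ M :⟺ ∀ a b, |ϖ^b ϖ^{−a} M_{ab}| ≤ 1`) is the stabiliser,
WITH inversion, of the EDGE `{v₀, v₁}` (★ `coe_mem_map_conj_glDiagonal_iff_sym2_glVertexAct_eq_of_v_eq_one`), and `I = K⁰ ∩ K♯ = {k ∈ K⁰ : |k₁₀|_w < 1}` has index `q + 1` in `K⁰`
and `2` in `K♯`.  (At the other ramified type — an anti-fixed UNIFORMISER — `K⁰` is the edge stabiliser and every `k ∈ K⁰` is residually diagonal or antidiagonal, ★ FILE A; here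
that dichotomy FAILS and the `K⁰`-average of `1_{K♯}` needs a new organ.)  For `u ∈ K⁰` with matrix `U` (`|det U| = 1`), and `g = t·n(y)` with `w`-matrix `G = [[d₀, d₀y], [0, d₁]]`,
`|dᵢ − 1| < 1` (DEEP), `σ_w y = −y`: from `M U = U G` for `M = U G U⁻¹` one reads the two identities
  `det U · M₁₀ = u₁₀ · (u₁₁(d₀ − d₁) − u₁₀ d₀ y)`,   `det U · d₀ y = u₁₁(M₀₀u₀₁ + M₀₁u₁₁) − u₀₁(M₁₀u₀₁ + M₁₁u₁₁)`.
If `P♯ M` then every `|M_{ab}| ≤ exp 1`, so `|y| ≤ exp 1`, so `|y| ≤ 1` (EVEN order, ★ F1) — then `G, M ∈ GL₂(𝒪_w)` and `P♯ M ⟺ |M₁₀| < 1 ⟺ |u₁₀|·|u₁₁(d₀−d₁) − u₁₀d₀y| < 1 ⟺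
|y| < 1 ∨ |u₁₀| < 1` (ultrametric: `|u₁₁(d₀ − d₁)| < 1`, `|d₀| = 1`).  Hence
  **`P♯(E₂(k (tn) k⁻¹)) ⟺ |y_w| ≤ 1 ∧ (|y_w| < 1 ∨ |k₁₀,w| < 1)`**  (`k ∈ K⁰`):
the set `{(k, n) : k(tn)k⁻¹ ∈ K♯}` is `(K⁰ × 𝔪-line) ∪ (I × 𝒪-line)`, whose `κ ⊗ μ_N`-mass `κ(K⁰)μ₀∕q + κ(I)(μ₀ − μ₀∕q) = 2κ(K⁰)μ₀∕(q+1)` (sequels F4: `(q+1)κ(I) = κ(K⁰)`; F2: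
the 𝔪-line has mass `μ₀∕q`) gives the type-unit Levi value `Φ_H(⟦(t,u)⟧, χ♯) = ν_H(K_H)·J_H(t)·2∕(q+1)` (sequel F5).
* §1 (one-place model) `forall_v_sharp_iff_valued_lt_one_of_mem_glInt` (`P♯ M ⟺ |M₁₀| < 1` on `GL₂(𝒪_w)`, place-generic), `valued_le_exp_one_of_forall_v_sharp` (`P♯ M ⇒ |M_{ab}| ≤ exp 1`),
  **`forall_v_sharp_conj_upper_iff_of_unit`** (the organ, on `u ∈ U_w ∩ GL₂(𝒪_w)` and an upper-triangular deep `g`).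
* §2 (CM carrier) **`forall_v_sharp_localNonsplitEquiv_conj_torus_unipotent_iff_of_unit`**: the same for `k ∈ U(Φ₂)(𝒪_v)`, `t ∈ T₂` with `glDiagonal 2 d = t`, `|dᵢ,w − 1| < 1`, `n ∈ N₂`
  — the shape consumed under ★ H-descent `classOrbitalIntegral_prod_eq_smul_integral_prod_of_torus_regular_of_nonsplit`.

## References
* [Tits1979] J. Tits, *Reductive groups over local fields*, PSPM 33.1 (1979), §2.7, §3.9 (ramified quasi-split `U(2)`: the tree of `SL₂`; vertex vs edge stabilisers; Iwahori subgroups).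
* [Serre1980Trees] J.-P. Serre, *Trees* (1980), Ch. II §1.3.
* [Rogawski1990] J. D. Rogawski, *Automorphic Representations of Unitary Groups in Three Variables*, Ann. of Math. Stud. 123 (1990), §3.6 p. 31; §4.9 Lemma 4.9.3 p. 56, Prop. 4.9.1 (b) p. 55.
* [Jacobowitz1962] R. Jacobowitz, *Hermitian forms over local fields*, Amer. J. Math. 84 (1962), §5 (the two ramified dyadic types).
-/

set_option autoImplicit false

noncomputable section

open MeasureTheory Measure Set Filter Topology NumberField IsDedekindDomain Matrix ValuativeRel
open scoped ENNReal NNReal ValuativeRel Matrix MatrixGroups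

namespace Literature.NumberTheory.Automorphic.UnitaryGroup

open Literature.NumberTheory.Automorphic Literature.NumberTheory.Automorphic.UnitaryGroup.HeisRing Literature.NumberTheory.Automorphic.UnitaryGroup.LineRing
open Literature.NumberTheory.LocalFields.RamifiedPlaceAntiFixedUnitParity

/-! ## §1 One-place model: `P♯` on `GL₂(𝒪_w)`, the entry bound, and the organ -/

section Place

variable (L : Type) [Field L] [NumberField L] [IsCMField L] {v : HeightOneSpectrum (𝓞 ↥(maximalRealSubfield L))}
  (w : PlacesOver L v) (hw : IsCMField.complexConj L • w.1 = w.1)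

/-- `ℤᵐ⁰` bookkeeping: `exp(m)·a ≤ exp(n) ⟺ a ≤ exp(n − m)`. [folklore] -/
private theorem exp_mul_le_exp_iff (a : WithZero (Multiplicative ℤ)) (m n : ℤ) : WithZero.exp m * a ≤ WithZero.exp n ↔ a ≤ WithZero.exp (n - m) := by
  by_cases ha : a = 0
  · simp [ha]
  · rw [← WithZero.exp_log ha, ← WithZero.exp_add, WithZero.exp_le_exp, WithZero.exp_le_exp]; omega

omit [IsCMField L] in
/-- `|ϖ z| ≤ 1 ⟺ |z| ≤ exp(1)` and `|ϖ⁻¹ z| ≤ 1 ⟺ |z| ≤ exp(−1)` for a uniformiser `ϖ` of `L_w`. [cite: Tits1979, §3.9] -/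
private theorem valued_uniformizer_mul_le_one_iff {ϖ : (w.1.adicCompletion L)} (hϖ : Valued.v ϖ = WithZero.exp (-1 : ℤ)) (z : (w.1.adicCompletion L)) :
    (Valued.v (ϖ * z) ≤ 1 ↔ Valued.v z ≤ WithZero.exp (1 : ℤ)) ∧ (Valued.v (ϖ⁻¹ * z) ≤ 1 ↔ Valued.v z ≤ WithZero.exp (-1 : ℤ)) := by
  rw [map_mul, map_mul, map_inv₀, hϖ, ← WithZero.exp_neg, neg_neg, ← WithZero.exp_zero, exp_mul_le_exp_iff, exp_mul_le_exp_iff]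
  exact ⟨by norm_num, by norm_num⟩

omit [IsCMField L] in
/-- Discreteness of `ℤᵐ⁰`: `x < 1 ⟺ x ≤ exp(−1)`. [folklore] -/
private theorem lt_one_iff_le_exp_neg_one (x : WithZero (Multiplicative ℤ)) : x < 1 ↔ x ≤ WithZero.exp (-1 : ℤ) := by
  rw [← WithZero.lt_mul_exp_iff_le WithZero.exp_ne_zero, ← WithZero.exp_add]
  simp

omit [IsCMField L] in
/-- **`P♯ M ⟺ |M₁₀|_w < 1` ON `GL₂(𝒪_w)`** (place-generic): for an INTEGRAL `M` the four entry conditions `|ϖ^b ϖ^{−a} M_{ab}| ≤ 1` of the `ϖ`-modular level reduce to the `(1,0)` one,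
`|ϖ⁻¹ M₁₀| ≤ 1 ⟺ |M₁₀| ≤ exp(−1) ⟺ |M₁₀| < 1` — `K⁰ ∩ K♯` is the residually upper-triangular (Iwahori) part of `K⁰`. [cite: Tits1979, §3.9] [cite: Serre1980Trees, Ch. II §1.3] -/
theorem forall_v_sharp_iff_valued_lt_one_of_mem_glInt (ϖ : (w.1.adicCompletion L)) (hϖ : Valued.v ϖ = WithZero.exp (-1 : ℤ))
    (M : Matrix (Fin 2) (Fin 2) (w.1.adicCompletion L)) (hM : ∀ i j, Valued.v (M i j) ≤ 1) :
    (∀ a b : Fin 2, Valued.v (ϖ ^ (b : ℕ) * (ϖ ^ (a : ℕ))⁻¹ * M a b) ≤ 1) ↔ Valued.v (M 1 0) < 1 := by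
  have hϖ1 : Valued.v ϖ ≤ 1 := by rw [hϖ, ← WithZero.exp_zero, WithZero.exp_le_exp]; norm_num
  constructor
  · intro h
    have h10 := h 1 0
    simp only [Fin.isValue, Fin.val_zero, pow_zero, Fin.val_one, pow_one, one_mul] at h10
    rw [lt_one_iff_le_exp_neg_one, ← (valued_uniformizer_mul_le_one_iff L w hϖ _).2]
    exact h10
  · intro h a b
    fin_cases a <;> fin_cases b
    · simp only [Fin.zero_eta, Fin.isValue, pow_zero, inv_one, mul_one, one_mul]
      exact hM 0 0
    · simp only [Fin.zero_eta, Fin.isValue, Fin.mk_one, pow_one, pow_zero, inv_one, mul_one]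
      rw [map_mul]; exact mul_le_one' hϖ1 (hM 0 1)
    · simp only [Fin.mk_one, Fin.isValue, Fin.zero_eta, pow_zero, pow_one, one_mul]
      rw [(valued_uniformizer_mul_le_one_iff L w hϖ _).2, ← lt_one_iff_le_exp_neg_one]
      exact h
    · simp only [Fin.mk_one, Fin.isValue, pow_one]
      rw [mul_inv_cancel₀ ((Valuation.ne_zero_iff _).1 (by rw [hϖ]; exact WithZero.exp_ne_zero)), one_mul]
      exact hM 1 1

omit [IsCMField L] in
/-- **`P♯ M ⇒ |M_{ab}|_w ≤ exp 1` for all `a b`**: the entries of an element of the `ϖ`-modular level `D_ϖ GL₂(𝒪_w) D_ϖ⁻¹` are bounded by `|ϖ|⁻¹` (the `(0,1)` entry) resp. `1`.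
[cite: Tits1979, §3.9] [cite: Serre1980Trees, Ch. II §1.3] -/
theorem valued_le_exp_one_of_forall_v_sharp (ϖ : (w.1.adicCompletion L)) (hϖ : Valued.v ϖ = WithZero.exp (-1 : ℤ))
    (M : Matrix (Fin 2) (Fin 2) (w.1.adicCompletion L)) (h : ∀ a b : Fin 2, Valued.v (ϖ ^ (b : ℕ) * (ϖ ^ (a : ℕ))⁻¹ * M a b) ≤ 1) (a b : Fin 2) :
    Valued.v (M a b) ≤ WithZero.exp (1 : ℤ) := by
  have hϖ0 : ϖ ≠ 0 := (Valuation.ne_zero_iff _).1 (by rw [hϖ]; exact WithZero.exp_ne_zero)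
  have h1e : (1 : WithZero (Multiplicative ℤ)) ≤ WithZero.exp (1 : ℤ) := by rw [← WithZero.exp_zero, WithZero.exp_le_exp]; norm_num
  have hm1e : WithZero.exp (-1 : ℤ) ≤ WithZero.exp (1 : ℤ) := WithZero.exp_le_exp.2 (by norm_num)
  have hab := h a b
  fin_cases a <;> fin_cases b
  · simp only [Fin.zero_eta, Fin.isValue, pow_zero, inv_one, mul_one, one_mul] at hab ⊢
    exact hab.trans h1e
  · simp only [Fin.zero_eta, Fin.isValue, Fin.mk_one, pow_one, pow_zero, inv_one, mul_one] at hab ⊢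
    exact ((valued_uniformizer_mul_le_one_iff L w hϖ _).1).1 hab
  · simp only [Fin.mk_one, Fin.isValue, Fin.zero_eta, pow_zero, pow_one, one_mul] at hab ⊢
    exact (((valued_uniformizer_mul_le_one_iff L w hϖ _).2).1 hab).trans hm1e
  · simp only [Fin.mk_one, Fin.isValue, pow_one] at hab ⊢
    rw [mul_inv_cancel₀ hϖ0, one_mul] at hab
    exact hab.trans h1e

set_option maxHeartbeats 1600000 in
include hw in
/-- **THE ORGAN (one-place model)**: at a ramified non-split `w` carrying an anti-fixed UNIT `α`, for `u ∈ U_w ∩ GL₂(𝒪_w)` (matrix `U`, `|det U| = 1`) and `g ∈ U_w` with matrix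
`[[d₀, d₀y], [0, d₁]]`, `|dᵢ − 1| < 1` (deep), `σ_w y = −y`:  **`P♯(u g u⁻¹) ⟺ |y| ≤ 1 ∧ (|y| < 1 ∨ |u₁₀| < 1)`**.  From `M U = U G` (`M = UGU⁻¹`):
`det U·M₁₀ = u₁₀(u₁₁(d₀ − d₁) − u₁₀d₀y)` and `det U·d₀y = u₁₁(M₀₀u₀₁ + M₀₁u₁₁) − u₀₁(M₁₀u₀₁ + M₁₁u₁₁)`; `P♯ M ⇒ |M_{ab}| ≤ exp 1 ⇒ |y| ≤ exp 1 ⇒ |y| ≤ 1` (even order, ★ F1); then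
`G`, `M` are integral and `P♯ M ⟺ |M₁₀| < 1 ⟺ |y| < 1 ∨ |u₁₀| < 1` (`|u₁₁(d₀−d₁)| < 1`, `|d₀| = 1`, ultrametric). [cite: Tits1979, §3.9] [cite: Serre1980Trees, Ch. II §1.3]
[cite: Rogawski1990, §4.9 Lemma 4.9.3 p. 56] [cite: Jacobowitz1962, §5] -/
theorem forall_v_sharp_conj_upper_iff_of_unit (he : v.asIdeal.ramificationIdx' w.1.asIdeal ≠ 1) {α : w.1.adicCompletion L}
    (hα : Valued.v α = 1) (hσα : galAdicCompletionMap (L := L) (IsCMField.complexConj L) hw α = -α)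
    (ϖ : (w.1.adicCompletion L)) (hϖ : Valued.v ϖ = WithZero.exp (-1 : ℤ))
    (u : ↥(unitaryGroupOfForm (galAdicCompletionMap (L := L) (IsCMField.complexConj L) hw) (placeForm (Matrix.of fun i j : Fin 2 => if i.val + j.val + 1 = 2 then (1 : L) else 0) w.1)))
    (hu : (u : GL (Fin 2) (w.1.adicCompletion L)) ∈ glInt 2 (w.1.adicCompletion L))
    (g : ↥(unitaryGroupOfForm (galAdicCompletionMap (L := L) (IsCMField.complexConj L) hw) (placeForm (Matrix.of fun i j : Fin 2 => if i.val + j.val + 1 = 2 then (1 : L) else 0) w.1)))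
    {d₀ d₁ y : w.1.adicCompletion L} (hg : ((g : GL (Fin 2) (w.1.adicCompletion L)) : Matrix (Fin 2) (Fin 2) (w.1.adicCompletion L)) = !![d₀, d₀ * y; 0, d₁])
    (hd₀ : Valued.v (d₀ - 1) < 1) (hd₁ : Valued.v (d₁ - 1) < 1) (hσy : galAdicCompletionMap (L := L) (IsCMField.complexConj L) hw y = -y) :
    (∀ a b : Fin 2, Valued.v (ϖ ^ (b : ℕ) * (ϖ ^ (a : ℕ))⁻¹ * (((u * g * u⁻¹ : ↥(unitaryGroupOfForm (galAdicCompletionMap (L := L) (IsCMField.complexConj L) hw) (placeForm (Matrix.of fun i j : Fin 2 => if i.val + j.val + 1 = 2 then (1 : L) else 0) w.1))) : GL (Fin 2) (w.1.adicCompletion L)) : Matrix (Fin 2) (Fin 2) (w.1.adicCompletion L)) a b) ≤ 1) ↔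
      Valued.v y ≤ 1 ∧ (Valued.v y < 1 ∨ Valued.v (((u : GL (Fin 2) (w.1.adicCompletion L)) : Matrix (Fin 2) (Fin 2) (w.1.adicCompletion L)) 1 0) < 1) := by
  haveI : Algebra.IsQuadraticExtension ↥(maximalRealSubfield L) L := IsCMField.isQuadraticExtension L
  -- names for the three matrices
  obtain ⟨U, hU⟩ : ∃ U : Matrix (Fin 2) (Fin 2) (w.1.adicCompletion L), U = ((u : GL (Fin 2) (w.1.adicCompletion L)) : Matrix (Fin 2) (Fin 2) (w.1.adicCompletion L)) := ⟨_, rfl⟩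
  obtain ⟨M, hM⟩ : ∃ M : Matrix (Fin 2) (Fin 2) (w.1.adicCompletion L), M = (((u * g * u⁻¹ : ↥(unitaryGroupOfForm (galAdicCompletionMap (L := L) (IsCMField.complexConj L) hw) (placeForm (Matrix.of fun i j : Fin 2 => if i.val + j.val + 1 = 2 then (1 : L) else 0) w.1))) : GL (Fin 2) (w.1.adicCompletion L)) : Matrix (Fin 2) (Fin 2) (w.1.adicCompletion L)) := ⟨_, rfl⟩
  rw [← hM, ← hU]
  -- valuation data on `d₀, d₁, U`
  have hd0 : Valued.v d₀ = 1 := by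
    have h := Valuation.map_eq_of_sub_lt (Valued.v : Valuation (w.1.adicCompletion L) _) (x := (1 : (w.1.adicCompletion L))) (y := d₀) (by rw [map_one]; exact hd₀)
    rwa [map_one] at h
  have hdd : Valued.v (d₀ - d₁) < 1 := by
    rw [show d₀ - d₁ = (d₀ - 1) - (d₁ - 1) by ring]
    exact Valuation.map_sub_lt _ hd₀ hd₁
  have hint : ∀ i j, Valued.v (U i j) ≤ 1 := fun i j => by rw [hU]; exact (coe_mem_glInt_iff_forall_v_le_one L w hw u).1 hu i j
  have hdet : Valued.v U.det = 1 := by rw [hU]; exact v_det_coe_eq_one_of_mem_placeForm L w hw u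
  -- `M U = U G`, read on three entries
  have hMU : M * U = U * !![d₀, d₀ * y; 0, d₁] := by
    have h := congrArg (fun x : ↥(unitaryGroupOfForm (galAdicCompletionMap (L := L) (IsCMField.complexConj L) hw) (placeForm (Matrix.of fun i j : Fin 2 => if i.val + j.val + 1 = 2 then (1 : L) else 0) w.1)) =>
      ((x : GL (Fin 2) (w.1.adicCompletion L)) : Matrix (Fin 2) (Fin 2) (w.1.adicCompletion L))) (show u * g * u⁻¹ * u = u * g by group)
    simp only [Subgroup.coe_mul, Units.val_mul] at h
    rw [hM, hU, ← hg]
    exact h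
  have e10 := congr_fun (congr_fun hMU 1) 0
  have e11 := congr_fun (congr_fun hMU 1) 1
  have e01 := congr_fun (congr_fun hMU 0) 1
  simp only [Matrix.mul_apply, Fin.sum_univ_two, Fin.isValue, Matrix.of_apply, Matrix.cons_val', Matrix.cons_val_zero, Matrix.cons_val_one,
    Matrix.cons_val_fin_one, mul_zero, add_zero] at e10 e11 e01
  -- the two key identities
  have key10 : U.det * M 1 0 = U 1 0 * (U 1 1 * (d₀ - d₁) - U 1 0 * d₀ * y) := by
    rw [Matrix.det_fin_two]; linear_combination (U 1 1) * e10 - (U 1 0) * e11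
  have key01 : U.det * (d₀ * y) = U 1 1 * (M 0 0 * U 0 1 + M 0 1 * U 1 1) - U 0 1 * (M 1 0 * U 0 1 + M 1 1 * U 1 1) := by
    rw [Matrix.det_fin_two]; linear_combination -(U 1 1) * e01 + (U 0 1) * e11
  -- the inner factor `u₁₁(d₀ − d₁) − u₁₀ d₀ y`: small iff `|y| < 1 ∨ |u₁₀| < 1` once `|y| ≤ 1`
  have hB1 : Valued.v (U 1 1 * (d₀ - d₁)) < 1 := by rw [map_mul, mul_comm]; exact mul_lt_one_of_lt_of_le hdd (hint 1 1)
  have hM10 : Valued.v (M 1 0) = Valued.v (U 1 0) * Valued.v (U 1 1 * (d₀ - d₁) - U 1 0 * d₀ * y) := by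
    have h := congrArg Valued.v key10
    rw [map_mul, hdet, one_mul, map_mul] at h
    exact h
  constructor
  · intro hP
    -- `|y| ≤ exp 1`, hence `|y| ≤ 1`
    have hMe : ∀ a b, Valued.v (M a b) ≤ WithZero.exp (1 : ℤ) := valued_le_exp_one_of_forall_v_sharp L w ϖ hϖ M hP
    have hmul : ∀ {x z : WithZero (Multiplicative ℤ)}, x ≤ 1 → z ≤ WithZero.exp (1 : ℤ) → x * z ≤ WithZero.exp (1 : ℤ) :=
      fun hx hz => by simpa only [one_mul] using mul_le_mul' hx hz
    have hmul' : ∀ {x z : WithZero (Multiplicative ℤ)}, x ≤ WithZero.exp (1 : ℤ) → z ≤ 1 → x * z ≤ WithZero.exp (1 : ℤ) :=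
      fun hx hz => by simpa only [mul_one] using mul_le_mul' hx hz
    have hy1 : Valued.v y ≤ WithZero.exp (1 : ℤ) := by
      have h := congrArg Valued.v key01
      rw [map_mul, hdet, one_mul, map_mul, hd0, one_mul] at h
      rw [h]
      refine Valuation.map_sub_le _ ?_ ?_
      · rw [map_mul]
        exact hmul (hint 1 1) (Valuation.map_add_le _ (by rw [map_mul]; exact hmul' (hMe 0 0) (hint 0 1)) (by rw [map_mul]; exact hmul' (hMe 0 1) (hint 1 1)))
      · rw [map_mul]
        exact hmul (hint 0 1) (Valuation.map_add_le _ (by rw [map_mul]; exact hmul' (hMe 1 0) (hint 0 1)) (by rw [map_mul]; exact hmul' (hMe 1 1) (hint 1 1)))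
    have hy : Valued.v y ≤ 1 := valued_le_one_of_valued_le_exp_one_of_complexConj_eq_neg_of_unit L w hw he hα hσα hσy hy1
    refine ⟨hy, ?_⟩
    -- `M` is integral (entries of `U G U⁻¹`), so `P♯ M ⟹ |M₁₀| < 1`
    have hsmall : Valued.v (M 1 0) < 1 := by
      have h10 := hP 1 0
      simp only [Fin.isValue, Fin.val_zero, pow_zero, Fin.val_one, pow_one, one_mul] at h10
      rw [lt_one_iff_le_exp_neg_one, ← (valued_uniformizer_mul_le_one_iff L w hϖ _).2]
      exact h10
    rw [hM10] at hsmall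
    by_cases hu10 : Valued.v (U 1 0) < 1
    · exact Or.inr hu10
    · left
      have hu1 : Valued.v (U 1 0) = 1 := le_antisymm (hint 1 0) (not_lt.1 hu10)
      rw [hu1, one_mul] at hsmall
      -- `|a − b| < 1`, `|a| < 1` ⇒ `|b| < 1`, with `b = u₁₀ d₀ y`, `|u₁₀ d₀| = 1`
      have hb : Valued.v (U 1 0 * d₀ * y) < 1 := by
        have h := Valuation.map_sub_lt _ hB1 hsmall
        rwa [sub_sub_cancel] at h
      rwa [map_mul, map_mul, hu1, hd0, one_mul, one_mul] at hb
  · rintro ⟨hy, hor⟩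
    -- `G` and hence `M` are integral
    have hMint : ∀ i j, Valued.v (M i j) ≤ 1 := by
      have hd1 : Valued.v d₁ = 1 := by
        have h := Valuation.map_eq_of_sub_lt (Valued.v : Valuation (w.1.adicCompletion L) _) (x := (1 : (w.1.adicCompletion L))) (y := d₁) (by rw [map_one]; exact hd₁)
        rwa [map_one] at h
      have hgint : (g : GL (Fin 2) (w.1.adicCompletion L)) ∈ glInt 2 (w.1.adicCompletion L) := by
        rw [mem_glInt_iff_forall_v_le_one_of_v_det_eq_one _ (by rw [hg, Matrix.det_fin_two_of, mul_zero, sub_zero, map_mul, hd0, hd1, one_mul]), hg]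
        intro i j
        fin_cases i <;> fin_cases j
        · exact hd0.le
        · show Valued.v (d₀ * y) ≤ 1
          rw [map_mul, hd0, one_mul]; exact hy
        · show Valued.v (0 : w.1.adicCompletion L) ≤ 1
          rw [map_zero]; exact zero_le
        · exact hd1.le
      have hmem : ((u * g * u⁻¹ : ↥(unitaryGroupOfForm (galAdicCompletionMap (L := L) (IsCMField.complexConj L) hw) (placeForm (Matrix.of fun i j : Fin 2 => if i.val + j.val + 1 = 2 then (1 : L) else 0) w.1))) : GL (Fin 2) (w.1.adicCompletion L)) ∈ glInt 2 (w.1.adicCompletion L) := by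
        rw [Subgroup.coe_mul, Subgroup.coe_mul, Subgroup.coe_inv]
        exact Subgroup.mul_mem _ (Subgroup.mul_mem _ hu hgint) (Subgroup.inv_mem _ hu)
      intro i j
      rw [hM]
      exact (coe_mem_glInt_iff_forall_v_le_one L w hw (u * g * u⁻¹)).1 hmem i j
    rw [forall_v_sharp_iff_valued_lt_one_of_mem_glInt L w ϖ hϖ M hMint, hM10]
    have hb : Valued.v (U 1 0 * d₀ * y) ≤ 1 := by
      rw [map_mul, map_mul, hd0, mul_one]; exact mul_le_one' (hint 1 0) hy
    rcases hor with hy' | hu10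
    · have hb' : Valued.v (U 1 0 * d₀ * y) < 1 := by
        rw [map_mul, map_mul, hd0, mul_one, mul_comm]; exact mul_lt_one_of_lt_of_le hy' (hint 1 0)
      rw [mul_comm]; exact mul_lt_one_of_lt_of_le (Valuation.map_sub_lt _ hB1 hb') (hint 1 0)
    · exact mul_lt_one_of_lt_of_le hu10 (Valuation.map_sub_le _ hB1.le hb)

end Place

/-! ## §2 On the CM carrier `U(Φ₂)(L⁺_v)`: the organ for `k ∈ U(Φ₂)(𝒪_v)`, `t ∈ T₂` deep, `n ∈ N₂` -/

section CM

variable (L : Type) [Field L] [NumberField L] [IsCMField L] (v : HeightOneSpectrum (𝓞 ↥(maximalRealSubfield L)))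
  (w : PlacesOver L v) (hw : IsCMField.complexConj L • w.1 = w.1)

set_option maxHeartbeats 1600000 in
set_option synthInstance.maxHeartbeats 400000 in
-- instance-term unification on the CM local carriers (two spellings of `U(Φ₂)(L⁺_v)`), as in ★ p846823 ∕ ★ p855329
include hw in
/-- **THE ORGAN ON THE CM CARRIER**: at a ramified non-split `w` carrying an anti-fixed UNIT `α`, for `k ∈ K⁰ = U(Φ₂)(𝒪_v)`, `t = diag(d₀, d₁) ∈ T₂` DEEP (`|dᵢ,w − 1| < 1`) and
`n = n(y) ∈ N₂`: **`P♯(E₂(k (tn) k⁻¹)) ⟺ |y_w| ≤ 1 ∧ (|y_w| < 1 ∨ |(E₂ k)₁₀| < 1)`** — i.e. `k(tn)k⁻¹ ∈ K♯` iff `tn ∈ K⁰` and (`tn ∈ K♭` or `k ∈ K⁰ ∩ K♯`).  §1 read through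
`E₂(k(tn)k⁻¹) = E₂k·E₂(tn)·(E₂k)⁻¹` (★ `coe_localNonsplitEquiv_conj`), `E₂(tn) = [[d₀,w, d₀,w y_w], [0, d₁,w]]` (★ `map_coe_torus_mul_unipotent_two`), `σ_w y_w = −y_w`
(★ `umat_zero_one_mem_skewPart`). [cite: Tits1979, §3.9] [cite: Rogawski1990, §4.9 Lemma 4.9.3 p. 56; §3.6 p. 31] [cite: Jacobowitz1962, §5] -/
theorem forall_v_sharp_localNonsplitEquiv_conj_torus_unipotent_iff_of_unit
    (K₂ : Subgroup ↥(unitaryGroupOfForm (conjLocal L (IsCMField.complexConj L) v) (cmLocalForm L 2 v))) (hK2 : K₂ = cmLocalIntegralLevel L 2 (Matrix.of fun i j : Fin 2 => if i.val + j.val + 1 = 2 then (1 : L) else 0) v)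
    (he : v.asIdeal.ramificationIdx' w.1.asIdeal ≠ 1) {α : w.1.adicCompletion L}
    (hα : Valued.v α = 1) (hσα : galAdicCompletionMap (L := L) (IsCMField.complexConj L) hw α = -α)
    (ϖ : (w.1.adicCompletion L)) (hϖ : Valued.v ϖ = WithZero.exp (-1 : ℤ))
    (t : ↥(cmBorelTriple L 2 v).M) {d : Fin 2 → (LocalRing L v)ˣ}
    (hd : glDiagonal 2 (LocalRing L v) d = ((t : ↥(unitaryGroupOfForm (conjLocal L (IsCMField.complexConj L) v) (cmLocalForm L 2 v))) : GL (Fin 2) (LocalRing L v)))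
    (ht1 : ∀ i : Fin 2, Valued.v ((((d i : (LocalRing L v)ˣ) : (LocalRing L v)) w) - 1) < 1)
    (k : ↥(unitaryGroupOfForm (conjLocal L (IsCMField.complexConj L) v) (cmLocalForm L 2 v))) (hk : k ∈ K₂) (n : ↥(cmBorelTriple L 2 v).N) :
    (∀ a b : Fin 2, Valued.v (ϖ ^ (b : ℕ) * (ϖ ^ (a : ℕ))⁻¹ * ((((localNonsplitEquiv (IsCMField.complexConj L) (Matrix.of fun i j : Fin 2 => if i.val + j.val + 1 = 2 then (1 : L) else 0) (IsCMField.complexConj_ne_one L) w hw) (k * ((t : ↥(unitaryGroupOfForm (conjLocal L (IsCMField.complexConj L) v) (cmLocalForm L 2 v))) * (n : ↥(unitaryGroupOfForm (conjLocal L (IsCMField.complexConj L) v) (cmLocalForm L 2 v)))) * k⁻¹) : ↥(unitaryGroupOfForm (galAdicCompletionMap (L := L) (IsCMField.complexConj L) hw) (placeForm (Matrix.of fun i j : Fin 2 => if i.val + j.val + 1 = 2 then (1 : L) else 0) w.1))) : GL (Fin 2) (w.1.adicCompletion L)) : Matrix (Fin 2) (Fin 2) (w.1.adicCompletion L)) a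 b) ≤ 1) ↔
      Valued.v (((((n : ↥(unitaryGroupOfForm (conjLocal L (IsCMField.complexConj L) v) (cmLocalForm L 2 v))) : GL (Fin 2) (LocalRing L v)) : Matrix (Fin 2) (Fin 2) (LocalRing L v)) 0 1) w) ≤ 1 ∧
        (Valued.v (((((n : ↥(unitaryGroupOfForm (conjLocal L (IsCMField.complexConj L) v) (cmLocalForm L 2 v))) : GL (Fin 2) (LocalRing L v)) : Matrix (Fin 2) (Fin 2) (LocalRing L v)) 0 1) w) < 1 ∨
          Valued.v (((((localNonsplitEquiv (IsCMField.complexConj L) (Matrix.of fun i j : Fin 2 => if i.val + j.val + 1 = 2 then (1 : L) else 0) (IsCMField.complexConj_ne_one L) w hw) k : ↥(unitaryGroupOfForm (galAdicCompletionMap (L := L) (IsCMField.complexConj L) hw) (placeForm (Matrix.of fun i j : Fin 2 => if i.val + j.val + 1 = 2 then (1 : L) else 0) w.1))) : GL (Fin 2) (w.1.adicCompletion L)) : Matrix (Fin 2) (Fin 2) (w.1.adicCompletion L)) 1 0) < 1) := by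
  haveI : Algebra.IsQuadraticExtension ↥(maximalRealSubfield L) L := IsCMField.isQuadraticExtension L
  have hκ := coe_localNonsplitEquiv_mem_glInt_of_mem L v w hw K₂ hK2 k hk
  -- the `w`-matrix of `t·n`
  have hg : ((((localNonsplitEquiv (IsCMField.complexConj L) (Matrix.of fun i j : Fin 2 => if i.val + j.val + 1 = 2 then (1 : L) else 0) (IsCMField.complexConj_ne_one L) w hw) ((t : ↥(unitaryGroupOfForm (conjLocal L (IsCMField.complexConj L) v) (cmLocalForm L 2 v))) * (n : ↥(unitaryGroupOfForm (conjLocal L (IsCMField.complexConj L) v) (cmLocalForm L 2 v)))) : ↥(unitaryGroupOfForm (galAdicCompletionMap (L := L) (IsCMField.complexConj L) hw) (placeForm (Matrix.of fun i j : Fin 2 => if i.val + j.val + 1 = 2 then (1 : L) else 0) w.1))) : GL (Fin 2) (w.1.adicCompletion L)) : Matrix (Fin 2) (Fin 2) (w.1.adicCompletion L)) =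
      !![((d 0 : (LocalRing L v)ˣ) : (LocalRing L v)) w, ((d 0 : (LocalRing L v)ˣ) : (LocalRing L v)) w * (((((n : ↥(unitaryGroupOfForm (conjLocal L (IsCMField.complexConj L) v) (cmLocalForm L 2 v))) : GL (Fin 2) (LocalRing L v)) : Matrix (Fin 2) (Fin 2) (LocalRing L v)) 0 1) w); 0, ((d 1 : (LocalRing L v)ˣ) : (LocalRing L v)) w] := by
    rw [coe_localNonsplitEquiv_two_eq_map L v w hw, map_coe_torus_mul_unipotent_two L v w t hd n]
  -- `y_w` is anti-fixed
  have hσy : galAdicCompletionMap (L := L) (IsCMField.complexConj L) hw ((((((n : ↥(unitaryGroupOfForm (conjLocal L (IsCMField.complexConj L) v) (cmLocalForm L 2 v))) : GL (Fin 2) (LocalRing L v)) : Matrix (Fin 2) (Fin 2) (LocalRing L v)) 0 1) w)) = -((((((n : ↥(unitaryGroupOfForm (conjLocal L (IsCMField.complexConj L) v) (cmLocalForm L 2 v))) : GL (Fin 2) (LocalRing L v)) : Matrix (Fin 2) (Fin 2) (LocalRing L v)) 0 1) w)) := by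
    rw [← conjLocal_apply_eq_of_smul_eq (IsCMField.complexConj L) (IsCMField.complexConj_ne_one L) v w hw,
      (mem_skewPart_iff _ _).1 (umat_zero_one_mem_skewPart (conjLocal L (IsCMField.complexConj L) v) (cmLocalForm_eq_over L 2 v) n), Pi.neg_apply]
  rw [coe_localNonsplitEquiv_conj L v w hw k]
  have h := forall_v_sharp_conj_upper_iff_of_unit L w hw he hα hσα ϖ hϖ _ hκ _ hg (ht1 0) (ht1 1) hσy
  rw [Subgroup.coe_mul, Subgroup.coe_inv] at h
  exact h

end CM

end Literature.NumberTheory.Automorphic.UnitaryGroup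

end
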